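import Literature.Probability.Percolation.ArmSeparationSepInit
import Literature.Probability.Percolation.ArmSeparationExtFourArmQ
import HarnessLib

/-!
# The initial estimate of the four-arm separation scheme, at `p`

Topic `Literature/Probability/Percolation`; family `crit-perc` / near-critical percolation on `𝕋`.
A brick of the near-critical arm-separation theorem for four arms of alternating colours
(P. Nolin, *Near-critical percolation in two dimensions*, EJP 13 (2008), Thm. 11 for `j = 4`,
`σ = BWBW` [arXiv 0711.4948: Thm. 10]; §4.3 Prop. 14, §4.4 first scale): at bounded ratio the
four well-separated alternating arms with landing areas on the sides `0, 2, 3, 5`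
(`sepFourArmQ m N`, `ArmSeparationExtFourArmQ`) have probability bounded below,
`P_p(sepFourArmQ m N) ≥ (c⁵)⁴` for `1100 ≤ m`, `2m ≤ N ≤ 10 m`, at a general parameter `p` with
Russo–Seymour–Welsh inputs at `p` and `1 - p` for boxes of height `≤ N`: the explicit fenced open arm
`sepInitArm m N` of `ArmSeparationSepInit` (five crossings, all boxes in the open cone
`{x₁ < 0 < x₀ + x₁}` of the right side) read in the four frames — the four framed supports are
pairwise disjoint, so the four events are independent (`sitePercolation_real_inter_of_disjoint`).

* `le_real_sepInitArm_at` — `P_q(sepInitArm m N) ≥ c⁵` (RSW at `q`, aspect ratio `≥ 1024`);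
* `sepInitArmFinset_cone` — the boxes lie in the cone of the right side;
* `pow_le_real_sepFourArmQ_at` — the estimate.

Everything here is proved; no named facts are introduced.

## References

* P. Nolin, Near-critical percolation in two dimensions, *Electron. J. Probab.* 13 (2008), §4.3
  Prop. 12 (proof) and Prop. 14, §4.4 (arXiv 0711.4948: Prop. 11, Prop. 13, proof of Thm. 10) [Nolin2008].
-/

noncomputable section

open MeasureTheory Set

namespace Literature.Probability.Percolation

open LatticeModels

/-- **RSW and Harris for the explicit arm at `q`**: if `c ≤ P_q(long-way crossing of
`[0, ⌊ρ k⌋] × [0, k]`)` for `1 ≤ k ≤ Ncap` (`ρ ≥ 1024`, `c ≥ 0`), then `P_q(sepInitArm m N) ≥ c⁵` for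
`1100 ≤ m`, `2m ≤ N ≤ 10m`, `N ≤ Ncap`. [cite: Nolin2008, §4.3 Prop. 14 (arXiv 0711.4948: Prop. 13)] -/
theorem le_real_sepInitArm_at (q : unitInterval) {c : ℝ} {ρ Ncap : ℕ}
    (hrsw : ∀ k : ℕ, 1 ≤ ⌊(ρ : ℝ) * k⌋₊ → k ≤ Ncap → c ≤ triLRCrossingProb q ⌊(ρ : ℝ) * k⌋₊ k)
    (hρ : 1024 ≤ ρ) (hc : 0 ≤ c) {m N : ℕ} (hm : 1100 ≤ m) (hmN : 2 * m ≤ N) (hN : N ≤ 10 * m) (hcap : N ≤ Ncap) :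
    c ^ 5 ≤ (triSitePercolation q).real (sepInitArm m N) := by
  have hfl : ∀ k : ℕ, ⌊(ρ : ℝ) * (k : ℕ)⌋₊ = ρ * k := fun k => by
    have : (ρ : ℝ) * (k : ℕ) = ((ρ * k : ℕ) : ℝ) := by push_cast; ring
    rw [this, Nat.floor_natCast]
  have hcw : ∀ L k : ℕ, 1 ≤ k → k ≤ Ncap → L ≤ 1024 * k → c ≤ triLRCrossingProb q L k := fun L k hk hkc hL => by
    have h := hrsw k (by rw [hfl]; nlinarith) hkc
    rw [hfl] at h
    exact h.trans (triLRCrossingProb_anti_width q (by nlinarith) k)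
  set F := sepInitArmFinset m N with hF
  set E1 := triVCross ((m : ℤ) - (m / 8 : ℕ) + 1) (-((m / 2 : ℕ) : ℤ) - (m / 64 : ℕ)) (m / 8 - 2) (2 * (m / 64)) with hE1
  set E2 := triHCross ((m : ℤ) - (m / 8 : ℕ) + 1) (-((m / 2 : ℕ) : ℤ)) (N - m + m / 8 - 2) (m / 64) with hE2
  set E3 := triVCross ((N : ℤ) - (N / 8 : ℕ)) (-((N / 2 : ℕ) : ℤ) - (N / 64 : ℕ)) (N / 8 - 1) (N / 2 + N / 64 - m / 2 + m / 64) with hE3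
  set E4 := triHCross ((N : ℤ) - (N / 8 : ℕ)) (-((N / 2 : ℕ) : ℤ) - (N / 64 : ℕ) + 1) (2 * (N / 8) - 1) (N / 64 - 1) with hE4
  set E5 := triVCross ((N : ℤ) + 2) (-((N / 2 : ℕ) : ℤ) - (N / 64 : ℕ)) (N / 8 - 3) (2 * (N / 64)) with hE5
  have c1 : (↑(triStripFinset ((m : ℤ) - (m / 8 : ℕ) + 1) (-((m / 2 : ℕ) : ℤ) - (m / 64 : ℕ)) (m / 8 - 2) (2 * (m / 64))) : Set (Site 2)) ⊆ ↑F :=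
    Finset.coe_subset.2 (Finset.subset_union_left.trans (Finset.subset_union_left.trans
      (Finset.subset_union_left.trans Finset.subset_union_left)))
  have c2 : (↑(triStripFinset ((m : ℤ) - (m / 8 : ℕ) + 1) (-((m / 2 : ℕ) : ℤ)) (N - m + m / 8 - 2) (m / 64)) : Set (Site 2)) ⊆ ↑F :=
    Finset.coe_subset.2 (Finset.subset_union_right.trans (Finset.subset_union_left.trans
      (Finset.subset_union_left.trans Finset.subset_union_left)))
  have c3 : (↑(triStripFinset ((N : ℤ) - (N / 8 : ℕ)) (-((N / 2 : ℕ) : ℤ) - (N / 64 : ℕ)) (N / 8 - 1) (N / 2 + N / 64 - m / 2 + m / 64)) :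
      Set (Site 2)) ⊆ ↑F :=
    Finset.coe_subset.2 (Finset.subset_union_right.trans (Finset.subset_union_left.trans Finset.subset_union_left))
  have c4 : (↑(triStripFinset ((N : ℤ) - (N / 8 : ℕ)) (-((N / 2 : ℕ) : ℤ) - (N / 64 : ℕ) + 1) (2 * (N / 8) - 1) (N / 64 - 1)) : Set (Site 2)) ⊆ ↑F :=
    Finset.coe_subset.2 (Finset.subset_union_right.trans Finset.subset_union_left)
  have c5 : (↑(triStripFinset ((N : ℤ) + 2) (-((N / 2 : ℕ) : ℤ) - (N / 64 : ℕ)) (N / 8 - 3) (2 * (N / 64))) : Set (Site 2)) ⊆ ↑F :=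
    Finset.coe_subset.2 Finset.subset_union_right
  have d1 : DeterminedBy E1 ↑F := (determinedBy_triVCross _ _ _ _).mono c1
  have d2 : DeterminedBy E2 ↑F := (determinedBy_triHCross _ _ _ _).mono c2
  have d3 : DeterminedBy E3 ↑F := (determinedBy_triVCross _ _ _ _).mono c3
  have d4 : DeterminedBy E4 ↑F := (determinedBy_triHCross _ _ _ _).mono c4
  have d5 : DeterminedBy E5 ↑F := (determinedBy_triVCross _ _ _ _).mono c5
  have u1 : IsUpperSet E1 := isUpperSet_triVCross _ _ _ _
  have u2 : IsUpperSet E2 := isUpperSet_triHCross _ _ _ _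
  have u3 : IsUpperSet E3 := isUpperSet_triVCross _ _ _ _
  have u4 : IsUpperSet E4 := isUpperSet_triHCross _ _ _ _
  have u5 : IsUpperSet E5 := isUpperSet_triVCross _ _ _ _
  have e1 : c ≤ (triSitePercolation q).real E1 := by
    rw [hE1, triSitePercolation_real_triVCross]; exact hcw _ _ (by omega) (by omega) (by omega)
  have e2 : c ≤ (triSitePercolation q).real E2 := by
    rw [hE2, triSitePercolation_real_triHCross]; exact hcw _ _ (by omega) (by omega) (by omega)
  have e3 : c ≤ (triSitePercolation q).real E3 := by
    rw [hE3, triSitePercolation_real_triVCross]; exact hcw _ _ (by omega) (by omega) (by omega)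
  have e4 : c ≤ (triSitePercolation q).real E4 := by
    rw [hE4, triSitePercolation_real_triHCross]; exact hcw _ _ (by omega) (by omega) (by omega)
  have e5 : c ≤ (triSitePercolation q).real E5 := by
    rw [hE5, triSitePercolation_real_triVCross]; exact hcw _ _ (by omega) (by omega) (by omega)
  have h12 := sitePercolation_harris q d1 d2 u1 u2
  have h123 := sitePercolation_harris q (d1.inter d2) d3 (u1.inter u2) u3
  have h1234 := sitePercolation_harris q ((d1.inter d2).inter d3) d4 ((u1.inter u2).inter u3) u4
  have h12345 := sitePercolation_harris q (((d1.inter d2).inter d3).inter d4) d5 (((u1.inter u2).inter u3).inter u4) u5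
  have hdef : sepInitArm m N = E1 ∩ E2 ∩ E3 ∩ E4 ∩ E5 := rfl
  unfold triSitePercolation at e1 e2 e3 e4 e5 ⊢
  rw [hdef]
  set μ := sitePercolation (Site 2) q with hμ
  have h0 : ∀ s, 0 ≤ μ.real s := fun s => measureReal_nonneg
  calc c ^ 5 = c * c * c * c * c := by ring
    _ ≤ μ.real E1 * μ.real E2 * μ.real E3 * μ.real E4 * μ.real E5 := by
        have := mul_le_mul e1 e2 hc (h0 _)
        have := mul_le_mul this e3 hc (mul_nonneg (h0 _) (h0 _))
        have := mul_le_mul this e4 hc (mul_nonneg (mul_nonneg (h0 _) (h0 _)) (h0 _))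
        exact mul_le_mul this e5 hc (mul_nonneg (mul_nonneg (mul_nonneg (h0 _) (h0 _)) (h0 _)) (h0 _))
    _ ≤ μ.real (E1 ∩ E2) * μ.real E3 * μ.real E4 * μ.real E5 :=
        mul_le_mul_of_nonneg_right (mul_le_mul_of_nonneg_right (mul_le_mul_of_nonneg_right h12 (h0 _)) (h0 _)) (h0 _)
    _ ≤ μ.real (E1 ∩ E2 ∩ E3) * μ.real E4 * μ.real E5 :=
        mul_le_mul_of_nonneg_right (mul_le_mul_of_nonneg_right h123 (h0 _)) (h0 _)
    _ ≤ μ.real (E1 ∩ E2 ∩ E3 ∩ E4) * μ.real E5 := mul_le_mul_of_nonneg_right h1234 (h0 _)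
    _ ≤ μ.real (E1 ∩ E2 ∩ E3 ∩ E4 ∩ E5) := h12345

/-- **The boxes of the explicit arm lie in the open cone of the right side**: `x₁ < 0 < x₀ + x₁`
(`64 ≤ m`, `2m ≤ N`). [folklore] -/
theorem sepInitArmFinset_cone {m N : ℕ} (hm : 64 ≤ m) (hmN : 2 * m ≤ N) {v : Site 2} (hv : v ∈ sepInitArmFinset m N) :
    v 1 < 0 ∧ 0 < v 0 + v 1 := by
  have ew := cast_sepInitArm_width (m := m) (N := N) (by omega) hmN
  have eh := cast_sepInitArm_height (m := m) (N := N) hmN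
  simp only [sepInitArmFinset, Finset.mem_union] at hv
  rcases hv with (((hv | hv) | hv) | hv) | hv <;>
    rw [← Finset.mem_coe, coe_triStripFinset, mem_triStrip] at hv
  · constructor <;> omega
  · rw [ew] at hv; constructor <;> omega
  · rw [eh] at hv; constructor <;> omega
  · constructor <;> omega
  · constructor <;> omega

/-- **The initial estimate of the four-arm scheme at `p`**: with the RSW input `hrsw` at `p` and at
`1 - p` (aspect ratio `ρ ≥ 1024`, heights `≤ Ncap`), `P_p(sepFourArmQ m N) ≥ (c⁵)⁴` for
`1100 ≤ m`, `2m ≤ N ≤ 10 m`, `N ≤ Ncap`: the explicit fenced open arm read in the four frames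
(independent: the framed supports lie in the four pairwise disjoint cones), each at cost `c⁵`
(`le_real_sepInitArm_at` at `p` for the open arms, at `1 - p` for the closed ones), and
`sepInitArm_subset_sepOpenArm`. [cite: Nolin2008, §4.3 Prop. 14, §4.4 (arXiv 0711.4948: Prop. 13; proof of Thm. 10, first scale)] -/
theorem pow_le_real_sepFourArmQ_at (p : unitInterval) {c : ℝ} {ρ Ncap : ℕ}
    (hrsw : ∀ q : unitInterval, (q = p ∨ q = unitInterval.symm p) →
      ∀ k : ℕ, 1 ≤ ⌊(ρ : ℝ) * k⌋₊ → k ≤ Ncap → c ≤ triLRCrossingProb q ⌊(ρ : ℝ) * k⌋₊ k)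
    (hρ : 1024 ≤ ρ) (hc : 0 ≤ c) {m N : ℕ} (hm : 1100 ≤ m) (hmN : 2 * m ≤ N) (hN : N ≤ 10 * m) (hcap : N ≤ Ncap) :
    (c ^ 5) ^ 4 ≤ (triSitePercolation p).real (sepFourArmQ m N) := by
  classical
  set A := sepInitArm m N with hA
  set F := sepInitArmFinset m N with hF
  have dA : DeterminedBy A ↑F := determinedBy_sepInitArm m N
  have dAf : ∀ i, DeterminedBy {ω : SiteConfig (Site 2) | frameConfig i ω ∈ A} ↑(F.image (frameIso i)) := fun i => by
    rw [Finset.coe_image]; exact determinedBy_preimage_frameConfig i dA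
  have dAfc : ∀ i, DeterminedBy {ω : SiteConfig (Site 2) | frameConfig i ωᶜ ∈ A} ↑(F.image (frameIso i)) := fun i => by
    have h2 : {ω : SiteConfig (Site 2) | frameConfig i ωᶜ ∈ A} =
        {ω : SiteConfig (Site 2) | ωᶜ ∈ {χ : SiteConfig (Site 2) | frameConfig i χ ∈ A}} := by
      ext ω; simp only [Set.mem_setOf_eq]
    rw [h2]; exact DeterminedBy.preimage_compl' (dAf i)
  have cone := fun {v : Site 2} (hv : v ∈ F) => sepInitArmFinset_cone (by omega) hmN hv
  -- pairwise disjointness of the framed supports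
  have disj : ∀ i j : ℕ, i ≠ j → (i = 0 ∨ i = 2 ∨ i = 3 ∨ i = 5) → (j = 0 ∨ j = 2 ∨ j = 3 ∨ j = 5) →
      Disjoint (F.image (frameIso i)) (F.image (frameIso j)) := by
    intro i j hij hi hj
    rw [Finset.disjoint_left]
    intro v hv hv'
    rw [Finset.mem_image] at hv hv'
    obtain ⟨u, hu, rfl⟩ := hv
    obtain ⟨w, hw, huw⟩ := hv'
    have cu := cone hu
    have cw := cone hw
    obtain ⟨u00, u01, -, -, u20, u21, u30, u31, -, -, u50, u51⟩ := frameIso_apply_formula u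
    obtain ⟨w00, w01, -, -, w20, w21, w30, w31, -, -, w50, w51⟩ := frameIso_apply_formula w
    have e0 := congrFun huw 0
    have e1 := congrFun huw 1
    rcases hi with rfl | rfl | rfl | rfl <;> rcases hj with rfl | rfl | rfl | rfl <;>
      first
        | exact absurd rfl hij
        | (simp only [u00, u01, u20, u21, u30, u31, u50, u51, w00, w01, w20, w21, w30, w31, w50, w51] at e0 e1; omega)
  -- the four framed events and their probabilities
  have h5 : ∀ q : unitInterval, (q = p ∨ q = unitInterval.symm p) → c ^ 5 ≤ (triSitePercolation q).real A :=
    fun q hq => le_real_sepInitArm_at q (hrsw q hq) hρ hc hm hmN hN hcap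
  have hA0 : {ω : SiteConfig (Site 2) | frameConfig 0 ω ∈ A} = A := by
    ext ω; simp only [Set.mem_setOf_eq]
    have : frameConfig 0 ω = ω := by ext v; rw [mem_frameConfig]; rfl
    rw [this]
  have r3 : (triSitePercolation p).real {ω : SiteConfig (Site 2) | frameConfig 3 ω ∈ A} = (triSitePercolation p).real A :=
    real_preimage_frameConfig p 3 A
  have rc : ∀ i, (triSitePercolation p).real {ω : SiteConfig (Site 2) | frameConfig i ωᶜ ∈ A} =
      (triSitePercolation (unitInterval.symm p)).real A := fun i => by
    have h2 : {ω : SiteConfig (Site 2) | frameConfig i ωᶜ ∈ A} = compl ⁻¹' {χ : SiteConfig (Site 2) | frameConfig i χ ∈ A} := by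
      ext ω; simp only [Set.mem_setOf_eq, Set.mem_preimage]
    rw [h2]
    unfold triSitePercolation
    rw [sitePercolation_real_preimage_compl]
    exact real_preimage_frameConfig (unitInterval.symm p) i A
  -- independence
  have dA0 : DeterminedBy A ↑(F.image (frameIso 0)) := by have h := dAf 0; rwa [hA0] at h
  have i02 := sitePercolation_real_inter_of_disjoint p dA0 (dAfc 2)
    (disj 0 2 (by norm_num) (Or.inl rfl) (Or.inr (Or.inl rfl)))
  have d02 : DeterminedBy (A ∩ {ω : SiteConfig (Site 2) | frameConfig 2 ωᶜ ∈ A}) ↑(F.image (frameIso 0) ∪ F.image (frameIso 2)) := by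
    rw [Finset.coe_union]
    exact (dA0.mono Set.subset_union_left).inter ((dAfc 2).mono Set.subset_union_right)
  have i023 := sitePercolation_real_inter_of_disjoint p d02 (dAf 3)
    (Finset.disjoint_union_left.2 ⟨disj 0 3 (by norm_num) (Or.inl rfl) (Or.inr (Or.inr (Or.inl rfl))),
      disj 2 3 (by norm_num) (Or.inr (Or.inl rfl)) (Or.inr (Or.inr (Or.inl rfl)))⟩)
  have d023 : DeterminedBy (A ∩ {ω : SiteConfig (Site 2) | frameConfig 2 ωᶜ ∈ A} ∩ {ω | frameConfig 3 ω ∈ A})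
      ↑(F.image (frameIso 0) ∪ F.image (frameIso 2) ∪ F.image (frameIso 3)) := by
    rw [Finset.coe_union]
    exact (d02.mono Set.subset_union_left).inter ((dAf 3).mono Set.subset_union_right)
  have i0235 := sitePercolation_real_inter_of_disjoint p d023 (dAfc 5)
    (Finset.disjoint_union_left.2 ⟨Finset.disjoint_union_left.2
      ⟨disj 0 5 (by norm_num) (Or.inl rfl) (Or.inr (Or.inr (Or.inr rfl))), disj 2 5 (by norm_num) (Or.inr (Or.inl rfl)) (Or.inr (Or.inr (Or.inr rfl)))⟩,
      disj 3 5 (by norm_num) (Or.inr (Or.inr (Or.inl rfl))) (Or.inr (Or.inr (Or.inr rfl)))⟩)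
  have hsub : A ∩ {ω : SiteConfig (Site 2) | frameConfig 2 ωᶜ ∈ A} ∩ {ω | frameConfig 3 ω ∈ A} ∩ {ω | frameConfig 5 ωᶜ ∈ A} ⊆
      sepFourArmQ m N := by
    rintro ω ⟨⟨⟨h0, h2⟩, h3⟩, h5'⟩
    exact ⟨sepInitArm_subset_sepOpenArm hm hmN h0, sepInitArm_subset_sepOpenArm hm hmN h2,
      sepInitArm_subset_sepOpenArm hm hmN h3, sepInitArm_subset_sepOpenArm hm hmN h5'⟩
  have hp := h5 p (Or.inl rfl)
  have hq := h5 (unitInterval.symm p) (Or.inr rfl)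
  have hc5 : 0 ≤ c ^ 5 := pow_nonneg hc 5
  unfold triSitePercolation at r3 rc hp hq i02 i023 i0235 ⊢
  calc (c ^ 5) ^ 4 = c ^ 5 * c ^ 5 * c ^ 5 * c ^ 5 := by ring
    _ ≤ (sitePercolation (Site 2) p).real A * (sitePercolation (Site 2) p).real {ω : SiteConfig (Site 2) | frameConfig 2 ωᶜ ∈ A} *
          (sitePercolation (Site 2) p).real {ω : SiteConfig (Site 2) | frameConfig 3 ω ∈ A} *
          (sitePercolation (Site 2) p).real {ω : SiteConfig (Site 2) | frameConfig 5 ωᶜ ∈ A} := by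
        rw [rc 2, r3, rc 5]
        have h0 : ∀ s, 0 ≤ (sitePercolation (Site 2) p).real s := fun s => measureReal_nonneg
        have h0' : ∀ s, 0 ≤ (sitePercolation (Site 2) (unitInterval.symm p)).real s := fun s => measureReal_nonneg
        have t2 := mul_le_mul hp hq hc5 (h0 _)
        have t3 := mul_le_mul t2 hp hc5 (mul_nonneg (h0 _) (h0' _))
        exact mul_le_mul t3 hq hc5 (mul_nonneg (mul_nonneg (h0 _) (h0' _)) (h0 _))
    _ = (sitePercolation (Site 2) p).real (A ∩ {ω : SiteConfig (Site 2) | frameConfig 2 ωᶜ ∈ A} ∩ {ω | frameConfig 3 ω ∈ A} ∩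
          {ω | frameConfig 5 ωᶜ ∈ A}) := by rw [i0235, i023, i02]
    _ ≤ (sitePercolation (Site 2) p).real (sepFourArmQ m N) := measureReal_mono hsub (measure_ne_top _ _)

end Literature.Probability.Percolation
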